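import Summits.ResolutionOfSingularities.ResolutionOfSingularities.Theorems.PurelyInseparableDim4ResConeDiagonalLinearPart
import Summits.ResolutionOfSingularities.ResolutionOfSingularities.Theorems.PurelyInseparableDim4TschirnhausCone
import HarnessLib
import HarnessLib.Audit.Tags

/-!
# Purely inseparable four-folds — THE RESIDUAL CONE THROUGH A DIAGONAL RE-PRESENTATION: initial form, residual form, power
# cone and `e_G` pass through `F_B = clean(U^p · θ(F_A)) + E` for a DIAGONAL unit-class `θ` (cell `res-dim4-pi`, K2(p)
# lane, slice B brick K24a, R1 part «cone through the swap», file 2 of 2)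

[OURS · counted 0 · cell `res-dim4-pi` · K2(p) lane (holder res-dim4-p-12 g3; K24a-R1 «rotation» = res-dim4-p-1, plan R1′ bus
2026-08-29 04:06Z); seat res-dim4-p-1 g4 over `…ResConeDiagonalLinearPart` (file 1) and res-dim4-p-7 g3's SN1 / SN3b
(`…SwapIdentity`, `…SwapRelation`).]  Nothing here proves K2(p)/K2(5), `NoIsolatedTrap p p` or resolution of singularities in
dimension ≥ 4 / characteristic `p`.  AI kernel work, weaker than expert review.

WHAT THE ROTATION STEP NEEDS (plan R1′): the virtual slot child `B` of a rotation step is related to the real child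
`A = c (k+1)` by `B.F = clean((x_f + τ)^p · θ(A.F)) + E`, `E ∈ (x_f^M)`, with `θ` DIAGONAL along the transposition `(a f)`
(SN1); `slot_step_readings` wants of `B`: `ord₀ = 6` (`SwapNorm.ordZero_of_rel`), isolation (`SwapNorm.isIsolated_of_rel`), and
`e_G = 3` / a power cone charging the free letter — THIS FILE (any `p`, no primality needed until §3):

* §1 **`initialForm_of_diag_rel`** — `ord₀ F_B = ord₀ F_A = o` and `in(F_B) = U(0)^p · J(in F_A)` (`p ∤ o`, `o < M`).
* §2 **`resForm_of_diag_rel`** — with boundaries `r_B = r_A ∘ π`: `resForm B = c · J(resForm A)`, `c ≠ 0`;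
  **`resForm_powerCone_of_diag_rel`** — a power cone `a·(Σ ℓᵢ xᵢ)^d` goes to `a′·(Σ ℓ′ᵢ xᵢ)^d`, `ℓ′_i = e_i(0)·ℓ_{π i}`, `a′ ≠ 0`.
* §3 **`finrank_additiveSubspace_powerCone`** — `dim A(a·L^d) = 3` for `a ≠ 0`, `ℓ ≠ 0`, `1 ≤ d < p`; hence
  **`finrank_resVertex_of_diag_rel`**: `e_G(B) = 3`.

[cite: CossartJannsenSaito2020, Def. 2.8, Def. 2.18] [cite: Hauser2010, §§F–G] bears_on: LADDER-RESOLUTION:D157-DOOR2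
(res-dim4-pi · K2(p) · slice B · K24a-R1 cone through the swap).  Supports stmt-ResolutionOfSingularities-16155 (helper).
-/

set_option linter.dupNamespace false -- mandated namespace of this single-conjunct summit

noncomputable section

namespace Summit.ResolutionOfSingularities.ResolutionOfSingularities.Theorems.PIDim4

namespace ResCone

open MvPolynomial Finset
open Literature.AlgebraicGeometry.Resolution
open Literature.AlgebraicGeometry.Resolution.CentreBlowup
open Literature.AlgebraicGeometry.Resolution.Hauser2010
open Literature.AlgebraicGeometry.Resolution.HauserPerlega2019
open PointBlowup (polarMap additiveSubspace)

variable {K : Type} [Field K]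

/-! ## 1. The initial form through a diagonal re-presentation -/

section Rel

variable (p : ℕ)
variable {π : Equiv.Perm (Fin 4)} {θ e : Fin 4 → MvPolynomial (Fin 4) K}

/-- `U^p − U(0)^p` has no constant term. [folklore] -/
theorem pow_sub_C_pow_mem (U : MvPolynomial (Fin 4) K) (n : ℕ) :
    U ^ n - C (constantCoeff U ^ n) ∈ originIdeal K := by
  rw [originIdeal, RingHom.mem_ker, map_sub, map_pow, MvPolynomial.eval_C, MvPolynomial.eval_zero, sub_self]

/-- Cleaning a homogeneous form of degree prime to `p` does nothing. [folklore] -/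
theorem deletePthPowers_of_isHomogeneous {H : MvPolynomial (Fin 4) K} {o : ℕ} (hH : H.IsHomogeneous o) (hpo : ¬ p ∣ o) :
    deletePthPowers p H = H := by
  classical
  ext d
  rw [coeff_deletePthPowers]
  split_ifs with hd
  · by_contra hne
    have hdeg : d.degree = o := by
      have := hH (Ne.symm hne)
      rwa [weight_one_eq_degree] at this
    exact hpo (hdeg ▸ FrameChange.dvd_degree_of_isPthPowerExponent p hd)
  · rfl

/-- **THE INITIAL FORM THROUGH A DIAGONAL RE-PRESENTATION**: `F_B = clean(U^p · θ(F_A)) + E` with `θ (π i) = x_i e_i`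
(`e_i(0) ≠ 0`), `U(0) ≠ 0`, `E ∈ 𝔪₀^M`, `ord₀ F_A = o`, `p ∤ o`, `o < M`: then `ord₀ F_B = o` and
`in(F_B) = U(0)^p · J(in F_A)`, `J` the linear part of `θ`. [OURS] [cite: Hauser2010, §§F–G] -/
theorem initialForm_of_diag_rel (hθ : ∀ i, θ (π i) = X i * e i) (he : ∀ i, constantCoeff (e i) ≠ 0)
    {U E F_A F_B : MvPolynomial (Fin 4) K} (hU : constantCoeff U ≠ 0) {M o : ℕ} (hE : E ∈ originIdeal K ^ M)
    (hrel : F_B = deletePthPowers p (U ^ p * aeval θ F_A) + E) (ho : ordZero F_A = o) (hpo : ¬ p ∣ o) (hoM : o < M) :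
    ordZero F_B = o ∧ initialForm F_B =
      C (constantCoeff U ^ p) * aeval (fun k => C (constantCoeff (e (π.symm k))) * X (π.symm k)) (initialForm F_A) := by
  classical
  set J : Fin 4 → MvPolynomial (Fin 4) K := fun k => C (constantCoeff (e (π.symm k))) * X (π.symm k) with hJ
  have hJ0 : ∀ k, constantCoeff (J k) = 0 := fun k => by
    rw [hJ]; simp only [map_mul, constantCoeff_C, constantCoeff_X, mul_zero]
  have hθ0 : ∀ k, constantCoeff (θ k) = 0 := fun k => by
    rw [diag_apply hθ]; simp only [map_mul, constantCoeff_X, zero_mul]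
  -- `F_A = in F_A + R`, `R ∈ 𝔪₀^{o+1}`
  have hinH : (initialForm F_A).IsHomogeneous o := Directrix.initialForm_isHomogeneous ho
  have hsupp : ∀ n ∈ F_A.support, o ≤ n.degree := fun n hn => by
    have h := Literature.Barriers.ResolutionOfSingularities.ordZero_le_of_coeff_ne_zero _ _
      (MvPolynomial.mem_support_iff.mp hn)
    rw [ho] at h
    exact_mod_cast h
  have hR : F_A - initialForm F_A ∈ originIdeal K ^ (o + 1) := by
    rw [IsolationCert.mem_originIdeal_pow_iff]
    intro d hd
    rw [coeff_sub, Directrix.initialForm_eq_homogeneousComponent ho, coeff_homogeneousComponent]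
    split_ifs with hdo
    · exact sub_self _
    · by_cases hmem : d ∈ F_A.support
      · exact absurd (le_antisymm (by have := hsupp d hmem; omega) (hsupp d hmem)) hdo
      · rw [MvPolynomial.notMem_support_iff.mp hmem, sub_zero]
  -- the homogeneous part `H = U(0)^p · J(in F_A)` and why it is not zero
  set H := C (constantCoeff U ^ p) * aeval J (initialForm F_A) with hH
  have hin0 : initialForm F_A ≠ 0 := by
    intro h0
    have h1 := Directrix.initialForm_eq_homogeneousComponent ho
    rw [h0] at h1
    obtain ⟨⟨d, hd, hdeg⟩, -⟩ := (ordZero_eq_nat_iff _ _).mp ho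
    have h2 : coeff d (homogeneousComponent o F_A) = coeff d F_A := by rw [coeff_homogeneousComponent, if_pos hdeg]
    rw [← h1, coeff_zero] at h2
    exact hd h2.symm
  have hHhom : H.IsHomogeneous o := by
    have h1 := (isHomogeneous_C (Fin 4) (constantCoeff U ^ p)).mul (isHomogeneous_aeval_linearPart e π hinH)
    rwa [zero_add] at h1
  have hH0 : H ≠ 0 := by
    rw [hH]
    refine mul_ne_zero (by rw [Ne, C_eq_zero]; exact pow_ne_zero _ hU) fun h0 => hin0 ?_
    exact eq_zero_of_aeval_linearPart_eq_zero he π h0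
  -- `U^p · θ(F_A) = H + (𝔪₀^{o+1})`
  have hθFA : aeval θ F_A - aeval J (initialForm F_A) ∈ originIdeal K ^ (o + 1) := by
    have h1 : aeval θ F_A - aeval θ (initialForm F_A) ∈ originIdeal K ^ (o + 1) := by
      rw [← map_sub]; exact SwapNorm.aeval_mem_pow hθ0 hR
    have h2 := aeval_sub_aeval_linearPart_mem hθ (P := initialForm F_A) (o := o) (fun n hn =>
      le_of_eq (by have := hinH (MvPolynomial.mem_support_iff.mp hn); rw [weight_one_eq_degree] at this; exact this.symm))
    have := Ideal.add_mem _ h1 h2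
    rwa [sub_add_sub_cancel] at this
  have hθo : aeval θ F_A ∈ originIdeal K ^ o := by
    have h1 : aeval J (initialForm F_A) ∈ originIdeal K ^ o := by
      rw [IsolationCert.mem_originIdeal_pow_iff]
      intro d hd
      exact (isHomogeneous_aeval_linearPart e π hinH).coeff_eq_zero (ne_of_lt hd)
    have := Ideal.add_mem _ (Ideal.pow_le_pow_right (Nat.le_succ o) hθFA) h1
    rwa [sub_add_cancel] at this
  have hUp : U ^ p * aeval θ F_A - H ∈ originIdeal K ^ (o + 1) := by
    have hsplit : U ^ p * aeval θ F_A - H =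
        (U ^ p - C (constantCoeff U ^ p)) * aeval θ F_A + C (constantCoeff U ^ p) * (aeval θ F_A - aeval J (initialForm F_A)) := by
      rw [hH]; ring
    rw [hsplit]
    refine Ideal.add_mem _ ?_ (Ideal.mul_mem_left _ _ hθFA)
    rw [pow_succ', ]
    exact Ideal.mul_mem_mul (pow_sub_C_pow_mem U p) hθo
  -- cleaning and the error keep `H + (𝔪₀^{o+1})`
  have hclean : deletePthPowers p (U ^ p * aeval θ F_A) - H ∈ originIdeal K ^ (o + 1) := by
    have h1 : deletePthPowers p (U ^ p * aeval θ F_A) =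
        H + deletePthPowers p (U ^ p * aeval θ F_A - H) := by
      conv_lhs => rw [show U ^ p * aeval θ F_A = H + (U ^ p * aeval θ F_A - H) by ring]
      rw [deletePthPowers_add, deletePthPowers_of_isHomogeneous p hHhom hpo]
    rw [h1, add_sub_cancel_left]
    exact SwapNorm.deletePthPowers_mem_pow p hUp
  have hFB : F_B = H + (deletePthPowers p (U ^ p * aeval θ F_A) - H + E) := by rw [hrel]; ring
  have hrest : deletePthPowers p (U ^ p * aeval θ F_A) - H + E ∈ originIdeal K ^ (o + 1) :=
    Ideal.add_mem _ hclean (Ideal.pow_le_pow_right (by omega) hE)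
  rw [hFB]
  exact ordZero_initialForm_of_add_mem hHhom hH0 hrest

/-! ## 2. The residual form -/

/-- The linear part on a boundary monomial: `J(x^r) = (∏ e(0)^r) · x^{r∘π}`. [folklore] -/
theorem aeval_linearPart_monomial (e : Fin 4 → MvPolynomial (Fin 4) K) (π : Equiv.Perm (Fin 4)) (r : Fin 4 →₀ ℕ) (c : K) :
    aeval (fun k => C (constantCoeff (e (π.symm k))) * X (π.symm k)) (monomial r c) =
      monomial (r.mapDomain π.symm) (c * r.prod fun k m => constantCoeff (e (π.symm k)) ^ m) := by
  classical
  rw [aeval_monomial, algebraMap_eq]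
  simp only [mul_pow]
  rw [Finsupp.prod_mul, prod_X_pow_eq_monomial, prod_C_pow_eq, C_mul_monomial, C_mul_monomial, mul_one]

/-- **THE RESIDUAL FORM THROUGH A DIAGONAL RE-PRESENTATION**: for states `A`, `B` with `B.F = clean(U^p · θ(A.F)) + E` as in
`initialForm_of_diag_rel`, `x^{r_A} ∣ A.F` and boundaries `r_B = r_A ∘ π`: `resForm B = c · J(resForm A)` with `c ≠ 0`. [OURS]
[cite: CossartJannsenSaito2020, Def. 2.8] -/
theorem resForm_of_diag_rel (hθ : ∀ i, θ (π i) = X i * e i) (he : ∀ i, constantCoeff (e i) ≠ 0)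
    {U E : MvPolynomial (Fin 4) K} {A B : State K} (hU : constantCoeff U ≠ 0) {M o : ℕ} (hE : E ∈ originIdeal K ^ M)
    (hrel : B.F = deletePthPowers p (U ^ p * aeval θ A.F) + E) (ho : ordZero A.F = o) (hpo : ¬ p ∣ o) (hoM : o < M)
    (hrA : ∀ d ∈ A.F.support, A.r ≤ d) (hrB : B.r = A.r.mapDomain π.symm) :
    ∃ c : K, c ≠ 0 ∧
      resForm B = C c * aeval (fun k => C (constantCoeff (e (π.symm k))) * X (π.symm k)) (resForm A) := by
  classical
  obtain ⟨-, hin⟩ := initialForm_of_diag_rel p hθ he hU hE hrel ho hpo hoM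
  refine ⟨constantCoeff U ^ p * A.r.prod fun k m => constantCoeff (e (π.symm k)) ^ m,
    mul_ne_zero (pow_ne_zero _ hU) (prod_constantCoeff_pow_ne_zero he π A.r), ?_⟩
  set c : K := constantCoeff U ^ p * A.r.prod fun k m => constantCoeff (e (π.symm k)) ^ m with hc
  unfold resForm
  rw [hin, ← monomial_mul_resForm hrA, map_mul, aeval_linearPart_monomial, one_mul, hrB, ← mul_assoc, C_mul_monomial,
    ← hc, show (monomial (Finsupp.mapDomain (⇑(Equiv.symm π)) A.r) c : MvPolynomial (Fin 4) K) =
      monomial (Finsupp.mapDomain (⇑(Equiv.symm π)) A.r) (1 : K) * C c by rw [mul_comm, C_mul_monomial, mul_one],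
    mul_assoc, divMonomial_monomial_mul, divMonomial_monomial_mul]

/-- The linear part on a linear form: `J(Σ ℓ_k x_k) = Σ_i (e_i(0) ℓ_{π i}) x_i`. [folklore] -/
theorem aeval_linearPart_linearForm (e : Fin 4 → MvPolynomial (Fin 4) K) (π : Equiv.Perm (Fin 4)) (ℓ : Fin 4 → K) :
    aeval (fun k => C (constantCoeff (e (π.symm k))) * X (π.symm k)) (∑ k, C (ℓ k) * X k) =
      ∑ i, C (constantCoeff (e i) * ℓ (π i)) * X i := by
  rw [map_sum]
  simp only [map_mul, aeval_C, aeval_X, algebraMap_eq]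
  rw [← Equiv.sum_comp π (fun k => C (ℓ k) * (C (constantCoeff (e (π.symm k))) * X (π.symm k)))]
  refine Finset.sum_congr rfl fun i _ => ?_
  simp only [Equiv.symm_apply_apply]
  ring

/-- **A POWER CONE THROUGH A DIAGONAL RE-PRESENTATION**: if `resForm A = a·(Σ ℓ_k x_k)^d` then
`resForm B = a′·(Σ ℓ′_i x_i)^d` with `ℓ′_i = e_i(0)·ℓ_{π i}` and `a′ ≠ 0` when `a ≠ 0`. [OURS]
[cite: CossartJannsenSaito2020, Def. 2.8] -/
theorem resForm_powerCone_of_diag_rel (hθ : ∀ i, θ (π i) = X i * e i) (he : ∀ i, constantCoeff (e i) ≠ 0)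
    {U E : MvPolynomial (Fin 4) K} {A B : State K} (hU : constantCoeff U ≠ 0) {M o : ℕ} (hE : E ∈ originIdeal K ^ M)
    (hrel : B.F = deletePthPowers p (U ^ p * aeval θ A.F) + E) (ho : ordZero A.F = o) (hpo : ¬ p ∣ o) (hoM : o < M)
    (hrA : ∀ d ∈ A.F.support, A.r ≤ d) (hrB : B.r = A.r.mapDomain π.symm) {a : K} {ℓ : Fin 4 → K} {d : ℕ}
    (hform : resForm A = C a * (∑ k, C (ℓ k) * X k) ^ d) (ha : a ≠ 0) :
    ∃ a' : K, a' ≠ 0 ∧ resForm B = C a' * (∑ i, C (constantCoeff (e i) * ℓ (π i)) * X i) ^ d := by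
  obtain ⟨c, hc, hres⟩ := resForm_of_diag_rel p hθ he hU hE hrel ho hpo hoM hrA hrB
  refine ⟨c * a, mul_ne_zero hc ha, ?_⟩
  rw [hres, hform, map_mul, map_pow, aeval_C, algebraMap_eq, aeval_linearPart_linearForm, map_mul, mul_assoc]

end Rel

/-! ## 3. A power cone has `e = 3` -/

/-- **THE ADDITIVE SUBSPACE OF A POWER CONE IS THE VERTEX HYPERPLANE**: for `a ≠ 0`, `ℓ ≠ 0`, `1 ≤ d < p`,
`w ∈ A(a·(Σ ℓᵢ xᵢ)^d) ⟺ Σ ℓᵢ wᵢ = 0`. [folklore] [cite: CossartJannsenSaito2020, Def. 2.18] -/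
theorem mem_additiveSubspace_powerCone_iff (p : ℕ) [Fact p.Prime] [CharP K p] {a : K} (ha : a ≠ 0) {ℓ : Fin 4 → K}
    (hℓ : ℓ ≠ 0) {d : ℕ} (hd1 : 1 ≤ d) (hdp : d < p) (w : Fin 4 → K) :
    w ∈ additiveSubspace (C a * (∑ i, C (ℓ i) * X i) ^ d) ↔ ∑ i, ℓ i * w i = 0 := by
  classical
  set L : MvPolynomial (Fin 4) K := ∑ i, C (ℓ i) * X i with hL
  have hpd : ∀ k, pderiv k (C a * L ^ d) = C (a * d * ℓ k) * L ^ (d - 1) := by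
    intro k
    rw [pderiv_C_mul, (pderiv k).leibniz_pow, hL, FrameChange.pderiv_linear, ← hL, smul_eq_mul, map_mul, map_mul,
      map_natCast]
    ring
  have hpolar : polarMap (C a * L ^ d) w = C (a * d * ∑ i, ℓ i * w i) * L ^ (d - 1) := by
    rw [polarMap_eq_sum_C_mul]
    simp_rw [hpd, ← mul_assoc, ← map_mul]
    rw [← Finset.sum_mul, ← map_sum]
    congr 2
    rw [Finset.mul_sum]
    exact Finset.sum_congr rfl fun i _ => by ring
  have hL0 : L ≠ 0 := by
    obtain ⟨i, hi⟩ := Function.ne_iff.mp hℓ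
    intro h0
    have h1 := congrArg (coeff (Finsupp.single i 1)) h0
    rw [hL, coeff_single_linearForm, coeff_zero] at h1
    exact hi h1
  have hdK : (d : K) ≠ 0 := natCast_ne_zero_of_lt p hd1 hdp
  unfold additiveSubspace
  rw [LinearMap.mem_ker, hpolar, mul_eq_zero, C_eq_zero, or_iff_left (pow_ne_zero _ hL0), mul_eq_zero,
    or_iff_right (mul_ne_zero ha hdK)]

/-- **A POWER CONE HAS `e = 3`**: `dim A(a·(Σ ℓᵢ xᵢ)^d) = 3` for `a ≠ 0`, `ℓ ≠ 0`, `1 ≤ d < p`. [folklore]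
[cite: CossartJannsenSaito2020, Def. 2.18] -/
theorem finrank_additiveSubspace_powerCone (p : ℕ) [Fact p.Prime] [CharP K p] {a : K} (ha : a ≠ 0) {ℓ : Fin 4 → K}
    (hℓ : ℓ ≠ 0) {d : ℕ} (hd1 : 1 ≤ d) (hdp : d < p) :
    Module.finrank K (additiveSubspace (C a * (∑ i, C (ℓ i) * X i) ^ d)) = 3 := by
  classical
  -- the functional `w ↦ Σ ℓᵢ wᵢ`
  set f : (Fin 4 → K) →ₗ[K] K := Fintype.linearCombination K ℓ ∘ₗ LinearMap.id with hf
  have hfw : ∀ w, f w = ∑ i, ℓ i * w i := fun w => by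
    rw [hf, LinearMap.comp_apply, LinearMap.id_apply, Fintype.linearCombination_apply]
    exact Finset.sum_congr rfl fun i _ => by rw [smul_eq_mul, mul_comm]
  have hker : additiveSubspace (C a * (∑ i, C (ℓ i) * X i) ^ d) = LinearMap.ker f := by
    ext w
    rw [mem_additiveSubspace_powerCone_iff p ha hℓ hd1 hdp, LinearMap.mem_ker, hfw]
  have hf0 : f ≠ 0 := by
    obtain ⟨i, hi⟩ := Function.ne_iff.mp hℓ
    intro h0
    have h1 := hfw (Pi.single i 1)
    rw [h0, LinearMap.zero_apply, Finset.sum_eq_single i (fun k _ hk => by rw [Pi.single_eq_of_ne hk, mul_zero])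
      (fun h => absurd (Finset.mem_univ i) h), Pi.single_eq_same, mul_one] at h1
    exact hi h1.symm
  rw [hker]
  exact finrank_ker_eq_three hf0

/-- **`e_G` THROUGH A DIAGONAL RE-PRESENTATION OF A POWER-CONE STATE**: with the data of `resForm_powerCone_of_diag_rel`,
`ℓ ≠ 0` and `1 ≤ d < p`, the re-presented state has `e_G = dim resVertex = 3`. [OURS] [cite: CossartJannsenSaito2020, Def. 2.18] -/
theorem finrank_resVertex_of_diag_rel (p : ℕ) [Fact p.Prime] [CharP K p] {π : Equiv.Perm (Fin 4)}
    {θ e : Fin 4 → MvPolynomial (Fin 4) K} (hθ : ∀ i, θ (π i) = X i * e i) (he : ∀ i, constantCoeff (e i) ≠ 0)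
    {U E : MvPolynomial (Fin 4) K} {A B : State K} (hU : constantCoeff U ≠ 0) {M o : ℕ} (hE : E ∈ originIdeal K ^ M)
    (hrel : B.F = deletePthPowers p (U ^ p * aeval θ A.F) + E) (ho : ordZero A.F = o) (hpo : ¬ p ∣ o) (hoM : o < M)
    (hrA : ∀ d ∈ A.F.support, A.r ≤ d) (hrB : B.r = A.r.mapDomain π.symm) {a : K} {ℓ : Fin 4 → K} {d : ℕ}
    (hform : resForm A = C a * (∑ k, C (ℓ k) * X k) ^ d) (ha : a ≠ 0) (hℓ : ℓ ≠ 0) (hd1 : 1 ≤ d) (hdp : d < p) :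
    Module.finrank K (resVertex B) = 3 := by
  obtain ⟨a', ha', hres⟩ := resForm_powerCone_of_diag_rel p hθ he hU hE hrel ho hpo hoM hrA hrB hform ha
  have hℓ' : (fun i => constantCoeff (e i) * ℓ (π i)) ≠ 0 := by
    obtain ⟨k, hk⟩ := Function.ne_iff.mp hℓ
    refine Function.ne_iff.mpr ⟨π.symm k, ?_⟩
    rw [Pi.zero_apply, Equiv.apply_symm_apply]
    exact mul_ne_zero (he _) hk
  unfold resVertex
  rw [hres]
  exact finrank_additiveSubspace_powerCone p ha' hℓ' hd1 hdp

end ResCone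

end Summit.ResolutionOfSingularities.ResolutionOfSingularities.Theorems.PIDim4

end
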